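import Summits.QuantumFields.BalabanUV.Beta.GAN24.StencilSlotCauchyOfShapes

/-!
# `BalabanUV.Beta.GAN24.LocStencilTelescope` — binder row G-an2-4 / (CONV-C), the row owner's CONTACT-TERM ROUTE, CT-4e's last step (`gen19/CT4-DESIGN-v0.md` §0:
# «By the triangle inequality over consecutive levels and `Σ_{i≥k} θ^i = θ^k∕(1−θ)` it suffices to bound CONSECUTIVE differences»): **A SEQUENCE OF LOCAL STENCIL
# FAMILIES WHOSE CONSECUTIVE DIFFERENCES ARE `C·θ^n`-SMALL IS `hSall ∕ hSdev`-CAUCHY** — `∀ k j, LocStencil (U (k+j) − U k) (C·(1−θ)⁻¹·θ^k) δ` (generic `d`).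

NOT IN PRINT; OUR BOOKKEEPING (road-P2 chair `b2b-balaban-gan24-p2`, gen 34; a generic helper for the owner's CT-4e `ContactCauchyAssembly` and for every later
tower of the S∕W slots — born sectors, CT-5's sym family, CT-W).  [folklore]: road S3's `StencilSlotCauchyOfShapes.locStencil_sub` ∕ `StencilSlotOfShapes.locStencil_mono'`
and Mathlib's geometric series BY NAME; 0 `def`, 0 cited facts, 0 `def … : Prop`, 0 sorry.  HONEST FRAMING (cell contract, verbatim): «discharging `BetaPertH` makes
Bałaban's UV stability UNCONDITIONAL — a real constructive-QFT result; it is NOT the continuum limit and NOT the Clay problem.»  HONEST DEPENDENCY (verbatim):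
«continuum YM on T⁴ ⇐ BetaPertH ∧ nine spine estimates (0/9 proved); BetaPertH ⇐ (D1) ∧ (D4) ∧ CAP+tail; G-an2-4 gates asym, D1 and NE2/3/4.»  NO estimate of Bałaban's;
discharges NOTHING of hSdev by itself; NEVER «G-an2-4 closed»; NOT (CONV-C) as typed, NOT D1, NOT BetaPertH, NOT continuum, NOT Clay.

## What is proved (generic `d`)
* `locStencil_zero` (`0 ≤ C ⇒ LocStencil 0 C δ`), `locStencil_sub_partial (hstep) k j` (`U (k+j) − U k` with constant `C·θ^k·Σ_{i<j} θ^i`),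
  **`locStencil_telescope (hC : 0 ≤ C) (hθ0 : 0 ≤ θ) (hθ1 : θ < 1) (hstep : ∀ n, LocStencil (U (n+1) − U n) (C·θ^n) δ) : ∀ k j, LocStencil (U (k+j) − U k) (C·(1−θ)⁻¹·θ^k) δ`**
  — LITERALLY the `hSall`∕`hSdev` binder shape of road FP's LEFT END (`∀ k j, LocStencil (U (k+j) − U k) (cS·θS^k) δS`) from consecutive differences.
-/

noncomputable section

open Finset
open scoped BigOperators
open Literature.MathematicalPhysics.QuantumFieldTheory
open Literature.MathematicalPhysics.QuantumFieldTheory.Balaban1983to89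
open Literature.MathematicalPhysics.QuantumFieldTheory.Balaban1983to89.Beta
open B12Sec2to5 (l1 l1_nonneg)
open ExpKernelCalculus (MKer)
open OneStepResolventKernel (Fib LocStencil)
open Summit.QuantumFields.BalabanUV.Beta.GAN24.StencilSlotCauchyOfShapes (locStencil_sub)
open Summit.QuantumFields.BalabanUV.Beta.GAN24.StencilSlotOfShapes (locStencil_mono')

namespace Summit.QuantumFields.BalabanUV.Beta.GAN24.LocStencilTelescope

variable {d : ℕ}

/-- [folklore] The zero family is a local stencil family with any nonnegative constant. -/
theorem locStencil_zero {C δ : ℝ} (hC : 0 ≤ C) :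
    LocStencil (d := d) (0 : Fin (d + 1) → (Fin (d + 1) → ℤ) → MKer (d + 1) (Fib d)) C δ := by
  intro κ u x y a b
  simp only [Pi.zero_apply, abs_zero]
  positivity

/-- [folklore] **PARTIAL TELESCOPE**: consecutive differences `C·θ^n` ⟹ `U (k+j) − U k` has constant `C·θ^k·Σ_{i<j} θ^i`. -/
theorem locStencil_sub_partial {U : ℕ → Fin (d + 1) → (Fin (d + 1) → ℤ) → MKer (d + 1) (Fib d)} {C θ δ : ℝ}
    (hstep : ∀ n, LocStencil (U (n + 1) - U n) (C * θ ^ n) δ) (k j : ℕ) :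
    LocStencil (U (k + j) - U k) (C * θ ^ k * ∑ i ∈ Finset.range j, θ ^ i) δ := by
  induction j with
  | zero =>
      simp only [Finset.sum_range_zero, mul_zero, Nat.add_zero, sub_self]
      exact locStencil_zero le_rfl
  | succ j ih =>
      have e : U (k + (j + 1)) - U k = (U (k + j + 1) - U (k + j)) + (U (k + j) - U k) := by
        rw [show k + (j + 1) = k + j + 1 by ring]; abel
      rw [e, Finset.sum_range_succ, mul_add, add_comm (C * θ ^ k * ∑ i ∈ Finset.range j, θ ^ i)]
      have h1 : LocStencil (U (k + j + 1) - U (k + j)) (C * θ ^ k * θ ^ j) δ := by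
        have h := hstep (k + j); rwa [pow_add, ← mul_assoc] at h
      have h2 := locStencil_sub (d := d) h1 (locStencil_mono' ih le_rfl le_rfl)
      -- `locStencil_sub` gives `(A) − (−B)`-free shape: rewrite the sum as a difference of a difference
      have e2 : (U (k + j + 1) - U (k + j)) + (U (k + j) - U k) = (U (k + j + 1) - U (k + j)) - (U k - U (k + j)) := by abel
      rw [e2]
      have h3 : LocStencil (U k - U (k + j)) (C * θ ^ k * ∑ i ∈ Finset.range j, θ ^ i) δ := by
        have h := locStencil_sub (d := d) (locStencil_zero (d := d) (δ := δ) (le_refl (0 : ℝ))) ih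
        rw [zero_sub, zero_add] at h
        intro κ u x y a b
        have hh := h κ u x y a b
        simp only [Pi.neg_apply, Pi.sub_apply, abs_neg] at hh ⊢
        rw [abs_sub_comm]
        exact hh
      exact locStencil_sub (d := d) h1 h3

/-- NOT IN PRINT; OUR BOOKKEEPING.  **THE TELESCOPE**: `0 ≤ C`, `0 ≤ θ < 1`, consecutive differences `LocStencil (U (n+1) − U n) (C·θ^n) δ` for every `n`
⟹ `∀ k j, LocStencil (U (k+j) − U k) (C·(1−θ)⁻¹·θ^k) δ` (`Σ_{i<j} θ^i ≤ (1−θ)⁻¹`, Mathlib's `hasSum_geometric_of_lt_one` + `sum_le_hasSum`). -/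
theorem locStencil_telescope {U : ℕ → Fin (d + 1) → (Fin (d + 1) → ℤ) → MKer (d + 1) (Fib d)} {C θ δ : ℝ} (hC : 0 ≤ C) (hθ0 : 0 ≤ θ) (hθ1 : θ < 1)
    (hstep : ∀ n, LocStencil (U (n + 1) - U n) (C * θ ^ n) δ) (k j : ℕ) :
    LocStencil (U (k + j) - U k) (C * (1 - θ)⁻¹ * θ ^ k) δ := by
  have hgeom : ∑ i ∈ Finset.range j, θ ^ i ≤ (1 - θ)⁻¹ :=
    sum_le_hasSum (Finset.range j) (fun i _ => pow_nonneg hθ0 i) (hasSum_geometric_of_lt_one hθ0 hθ1)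
  refine locStencil_mono' (locStencil_sub_partial hstep k j) ?_ le_rfl
  have hk : 0 ≤ C * θ ^ k := by positivity
  calc C * θ ^ k * ∑ i ∈ Finset.range j, θ ^ i ≤ C * θ ^ k * (1 - θ)⁻¹ := mul_le_mul_of_nonneg_left hgeom hk
    _ = C * (1 - θ)⁻¹ * θ ^ k := by ring

end Summit.QuantumFields.BalabanUV.Beta.GAN24.LocStencilTelescope

end
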